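import Summits.QuantumFields.YangMills.Theorems.FemtoCutoffLadderWalledEigen
import HarnessLib

/-!
# Walled EIGENFUNCTIONS (brick 4 of the walled spectral package — route `FemtoCutoffLadder`, crux `LocalWallStep` stmt-QuantumFields-26282,
# cancellation route): honest, physical, walled, `l2`-orthonormal representatives with the POINTWISE hard-wall eigen-equation

Seat `leafhand-qf-femtocutoffladder-2` g0 (2026-08-30), `--supports stmt-QuantumFields-26282`.  From the abstract walled eigenvectors `e_j` of
brick 3 (`exists_walledEigen`, review lane) honest functions are produced WITHOUT a «projection = multiplication by `1_S`» calculus on `L²`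
classes: `φ_j := ev_j⁻¹ · 1_S · K_β e_j` (`K_β e_j` = the everywhere-defined kernel integral of the class, physical by
`isPhys_transferApply_coe`; cut by the invariant good set).  Its class is `e_j` because `toL2 φ_j − e_j` lies in the walled subspace and is
orthogonal to the DENSE walled core (`⟪χ, toL2 φ_j⟫ = ev⁻¹∫χ K_β e_j = ev⁻¹⟪χ, A e_j⟫ = ⟪χ, e_j⟫` for walled `χ`); then
`K_β(1_S K_β e_j) = K_β(ev_j e_j) = ev_j K_β e_j` gives the hard-wall eigen-equation `1_S · K_β φ_j = ev_j φ_j` EVERYWHERE.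
★ `exists_walledEigenfunctions`: for `β ≥ 0`, invariant measurable `S` with `walledL2 L S` infinite-dimensional, and `n` levels with
`ev_{n−1} > 0`: physical walled `φ₀,…,φ_{n−1}`, `l2`-orthonormal, `1_S · K_β φ_j = ev_j φ_j` pointwise, `ev` antitone with `ev₀ = t_S`, `ev₁ = s_S`
(tree's walled values), and the weak form `⟨f, K_β φ_j⟩ = ev_j ⟨f, φ_j⟩` for every walled physical `f`.
Remaining: walled Jentzsch (simplicity/positivity of `φ₀` on `S`), then ✓`energy_mul_eq` gives the Doob identity; the XL comparison.
HONEST FRAMING: fixed-lattice functional analysis; R2b1 RECORD rung — not infinite volume, not a mass gap, not Clay; no summit is proved by this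
file.  No definitions, no named facts, no `sorry`.  [cite: ReedSimonIV1978, Thm. XIII.1] [cite: ReedSimonI1980, Thm. VI.16]
-/

set_option autoImplicit false

noncomputable section

open MeasureTheory Filter Topology Real
open Literature.MathematicalPhysics.QuantumFieldTheory
open Literature.MathematicalPhysics.QuantumLattice
open Literature.Analysis.OperatorTheory
open scoped InnerProductSpace

namespace Summit.QuantumFields.YangMills.Theorems.FemtoTransferGap.PhysL2

open Summit.QuantumFields.YangMills.Theorems.FemtoTransferGap

variable {L : ℕ} [NeZero L]

/-- **Density gives uniqueness**: an element of the walled closed subspace orthogonal to every walled core class is zero. [folklore] -/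
theorem eq_zero_of_inner_walledCore {S : Set (GaugeConfig 3 L SU2)} {x : Lp ℝ 2 (configMeasure SU2 L)} (hx : x ∈ walledL2 L S)
    (h : ∀ (ψ : physSubmodule L), ψ ∈ walledSub L S → ⟪toL2 ψ, x⟫_ℝ = 0) : x = 0 := by
  have hP : IsClosed {y : Lp ℝ 2 (configMeasure SU2 L) | ⟪y, x⟫_ℝ = 0} :=
    isClosed_eq (continuous_id.inner continuous_const) continuous_const
  have hself : ⟪x, x⟫_ℝ = 0 := walledL2_induction hP (fun ψ hψ => h ψ hψ) hx
  exact inner_self_eq_zero.mp hself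

/-- ★ **Walled eigenfunctions.**  See the module docstring. [cite: ReedSimonIV1978, Thm. XIII.1–2] -/
theorem exists_walledEigenfunctions {β : ℝ} (hβ : 0 ≤ β) {S : Set (GaugeConfig 3 L SU2)} (hSm : MeasurableSet S)
    (hSg : ∀ (g : Site 3 L → SU2) (U : GaugeConfig 3 L SU2), gaugeTransform g U ∈ S ↔ U ∈ S)
    (hSz : ∀ (k : Fin 3), ∀ z ∈ Subgroup.center SU2, ∀ U : GaugeConfig 3 L SU2, twist k z U ∈ S ↔ U ∈ S)
    (hinf : ¬ FiniteDimensional ℝ (walledL2 L S)) (n : ℕ) :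
    ∃ (ev : Fin n → ℝ), Antitone ev ∧
      (∀ j : Fin n, (j : ℕ) = 0 →
        ev j = sSup (rayleighSet su2Rep L β fun ψ => ∀ U : GaugeConfig 3 L SU2, U ∉ S → ψ U = 0)) ∧
      (∀ j : Fin n, (j : ℕ) = 1 →
        ev j = sInf {x : ℝ | ∃ φ : GaugeConfig 3 L SU2 → ℝ, IsPhys φ ∧
          x = sSup (rayleighSet su2Rep L β fun ψ => (∀ U : GaugeConfig 3 L SU2, U ∉ S → ψ U = 0) ∧ l2 ψ φ = 0)}) ∧
      ((∀ j, 0 < ev j) → ∃ φ : Fin n → (GaugeConfig 3 L SU2 → ℝ),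
        (∀ j, IsPhys (φ j)) ∧ (∀ j U, U ∉ S → φ j U = 0) ∧
        (∀ i l, l2 (φ i) (φ l) = if i = l then 1 else 0) ∧
        (∀ j U, S.indicator (transferApply β (φ j)) U = ev j * φ j U) ∧
        (∀ j (f : GaugeConfig 3 L SU2 → ℝ), IsPhys f → (∀ U, U ∉ S → f U = 0) →
          qform su2Rep β f (φ j) = ev j * l2 f (φ j))) := by
  classical
  obtain ⟨A, hA, hsa, hc⟩ := exists_transferOpL2 (L := L) β
  obtain ⟨T, e, ev, hin, hon, heig, hanti, -, hev0, hev1⟩ := exists_walledEigen hβ hA hsa hc hSm hSg hSz hinf n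
  refine ⟨ev, hanti, hev0, hev1, fun hevpos => ?_⟩
  -- `A e_j` pairs like `ev_j e_j` against the walled subspace
  have hAe : ∀ j (v : walledL2 L S), ⟪(v : Lp ℝ 2 (configMeasure SU2 L)), A (e j)⟫_ℝ =
      ev j * ⟪(v : Lp ℝ 2 (configMeasure SU2 L)), (e j : Lp ℝ 2 (configMeasure SU2 L))⟫_ℝ := fun j v => by
    rw [← hin, heig, Submodule.coe_inner, Submodule.coe_smul, real_inner_smul_right]
  -- the honest representatives
  have heV : ∀ j, (e j : Lp ℝ 2 (configMeasure SU2 L)) ∈ physL2 L := fun j => walledL2_le_physL2 S (e j).2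
  set g : Fin n → (GaugeConfig 3 L SU2 → ℝ) := fun j =>
    transferApply β ((e j : Lp ℝ 2 (configMeasure SU2 L)) : GaugeConfig 3 L SU2 → ℝ) with hgdef
  have hg : ∀ j, IsPhys (g j) := fun j => isPhys_transferApply_coe β (heV j)
  have hgS : ∀ j, IsPhys (S.indicator (g j)) := fun j => OffTube.isPhys_indicator hSm hSg hSz (hg j)
  set φ : Fin n → (GaugeConfig 3 L SU2 → ℝ) := fun j => (ev j)⁻¹ • S.indicator (g j) with hφdef
  have hφ : ∀ j, IsPhys (φ j) := fun j => (hgS j).smul _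
  have hφS : ∀ j U, U ∉ S → φ j U = 0 := fun j U hU => by
    simp only [hφdef, Pi.smul_apply, smul_eq_mul, Set.indicator_of_notMem hU, mul_zero]
  have hφmem : ∀ j, (⟨φ j, hφ j⟩ : physSubmodule L) ∈ walledSub L S := fun j U hU => hφS j U hU
  -- the class of `φ_j` is `e_j`
  have hclass : ∀ j, toL2 ⟨φ j, hφ j⟩ = (e j : Lp ℝ 2 (configMeasure SU2 L)) := by
    intro j
    have hdiff : toL2 ⟨φ j, hφ j⟩ - (e j : Lp ℝ 2 (configMeasure SU2 L)) ∈ walledL2 L S :=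
      Submodule.sub_mem _ (walledCore_le_walledL2 S (toL2_mem_walledCore (hφmem j))) (e j).2
    have hzero := eq_zero_of_inner_walledCore hdiff (fun χ hχ => ?_)
    · exact sub_eq_zero.mp hzero
    rw [inner_sub_right, inner_toL2, inner_toL2_left]
    -- `∫ χ φ_j = ev⁻¹ ∫ χ (K e_j) = ev⁻¹ ⟪toL2 χ, A e_j⟫ = ⟪toL2 χ, e_j⟫`
    have h1 : l2 (χ : GaugeConfig 3 L SU2 → ℝ) (φ j) = (ev j)⁻¹ * l2 (χ : GaugeConfig 3 L SU2 → ℝ) (g j) := by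
      rw [hφdef]
      show l2 (χ : GaugeConfig 3 L SU2 → ℝ) ((ev j)⁻¹ • S.indicator (g j)) = _
      rw [l2_comm, l2_smul_left, l2_comm, l2_indicator_right_of_walled hχ]
    have h2 : l2 (χ : GaugeConfig 3 L SU2 → ℝ) (g j) = ⟪toL2 χ, A (e j : Lp ℝ 2 (configMeasure SU2 L))⟫_ℝ := by
      rw [inner_toL2_left]
      unfold l2
      refine integral_congr_ae ?_
      filter_upwards [hA (e j : Lp ℝ 2 (configMeasure SU2 L))] with U hU
      rw [hU]
      simp only [hgdef, transferApply_apply]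
    have h3 : ⟪toL2 χ, A (e j : Lp ℝ 2 (configMeasure SU2 L))⟫_ℝ =
        ev j * ⟪toL2 χ, (e j : Lp ℝ 2 (configMeasure SU2 L))⟫_ℝ := by
      have := hAe j (toW χ hχ)
      rwa [coe_toW] at this
    rw [h1, h2, h3, ← mul_assoc, inv_mul_cancel₀ (hevpos j).ne', one_mul, inner_toL2_left, sub_self]
  -- `φ_j =ᵐ e_j`, hence `K_β (1_S g_j) = ev_j g_j` pointwise
  have hae : ∀ j, φ j =ᵐ[configMeasure SU2 L] ((e j : Lp ℝ 2 (configMeasure SU2 L)) : GaugeConfig 3 L SU2 → ℝ) := fun j => by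
    have h := coeFn_toL2 (⟨φ j, hφ j⟩ : physSubmodule L)
    rw [hclass j] at h
    exact h.symm
  have hKφ : ∀ j, transferApply β (φ j) = g j := fun j => by
    rw [transferApply_congr_ae (hae j)]
  refine ⟨φ, hφ, hφS, fun i l => ?_, fun j U => ?_, fun j f hf hfS => ?_⟩
  · -- orthonormality
    rw [show l2 (φ i) (φ l) = l2 ((⟨φ i, hφ i⟩ : physSubmodule L) : GaugeConfig 3 L SU2 → ℝ) (⟨φ l, hφ l⟩ : physSubmodule L)
      from rfl, ← inner_toL2, hclass, hclass, ← Submodule.coe_inner]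
    exact (orthonormal_iff_ite.mp hon) i l
  · -- the hard-wall eigen-equation, pointwise
    rw [hKφ j]
    by_cases hU : U ∈ S
    · rw [Set.indicator_of_mem hU]
      simp only [hφdef, Pi.smul_apply, smul_eq_mul, Set.indicator_of_mem hU]
      rw [← mul_assoc, mul_inv_cancel₀ (hevpos j).ne', one_mul]
    · rw [Set.indicator_of_notMem hU, hφS j U hU, mul_zero]
  · -- the weak form against walled physical test functions
    have hne : ev j ≠ 0 := (hevpos j).ne'
    rw [qform_eq_l2_transferApply, hKφ j]
    unfold l2
    rw [← integral_const_mul]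
    refine integral_congr_ae (ae_of_all _ fun U => ?_)
    by_cases hU : U ∈ S
    · simp only [hφdef, Pi.smul_apply, smul_eq_mul, Set.indicator_of_mem hU]
      field_simp
    · simp only [hfS U hU, zero_mul, mul_zero]

end Summit.QuantumFields.YangMills.Theorems.FemtoTransferGap.PhysL2

end
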